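import Literature.Analysis.FluidPDE.PineauVicolWeightBounds
import Literature.Analysis.FluidPDE.CaloricRemainderCalculus

/-!
# Route `FilamentSkeletonRss` · negative item `NoExactProfileNearSymmetricPair` (stmt-NavierStokesRegularity-24091) — S_γ groundwork (B3):
# the GENERALISED (ground-state) MINIMUM PRINCIPLE for second-order operators with a zeroth-order term of the «wrong» sign

Helper file (theorems only), `--supports stmt-NavierStokesRegularity-24091 --as helper`; LEAD of 23611 / registrar of 23920, lane ns-filament-21221-p1 g15.

WHY.  The scalar equations met on the adjoint side of B2′ (design note `Cruxes/TransverseReductionRJ/Lines/defect_column_gate_1AR_B2_gamma.md`, step (γ-1); brick (B1)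
`…NoExactProfileAdjointEnergy`: `Δq + Dq[v] + q + 2⟪DU·Ψ,Ψ⟫ ≥ 0` for `q = |Ψ|²`, `Δh + Dh[v] + ½h = −⟪Ψ, ∂₃U⟫` for `h = ⟪Ψ, e₃⟫`) have zeroth-order coefficients
`c > 0`, for which the weak maximum principle (tree: `PineauVicol2026.weak_maximum_principle`, which needs `V = −c ≥ 0`) FAILS on large domains — and the B2′ domains
are huge (`diam ~ √Γ`).  The classical remedy (Protter–Weinberger 1967/1984, Ch. 2 §5, Thm. 10) is the GROUND-STATE TRANSFORM: if `L = Δ + b·∇ + c` admits a POSITIVE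
supersolution `ψ` (`Lψ ≤ 0`, `ψ > 0`), then `w = h/ψ` obeys `Δw + (b + 2∇ψ/ψ)·∇w + (Lψ/ψ)·w = Lh/ψ`, whose zeroth-order coefficient `Lψ/ψ ≤ 0` has the right sign, so
supersolutions `h` of `L` with `h ≥ 0` on `∂D` are `≥ 0` on `D̄` — on domains of ANY size.  For the free scalar adjoint operator `Δ + (½y − α e₃×y)·∇ + ½` such a `ψ`
exists globally (the free committor `ψ(y) = ∫₀¹ e^{−t²|y|²/4} dt`, brick (B2)); this file is the abstract principle.

* `laplacian_mul_drift_identity` — the transform identity `L(ψw) = ψ·(Δw + Dw[b]) + 2·Dw[∇ψ] + w·Lψ` (`ψ, w ∈ C²`);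
* `generalized_min_principle` — `D` bounded open; `b`, `c` bounded on `D`; `ψ ∈ C²` positive with `Lψ ≤ 0` on `D`; `h ∈ C²` with `Lh ≤ 0` on `D`, `h ≥ 0` on `∂D`
  ⇒ `h ≥ 0` on `D̄` [cite: ProtterWeinberger1984, Ch. 2 §5 Theorem 10];
* `generalized_comparison` — comparison form: `L ū ≤ L u` on `D` and `u ≤ ū` on `∂D` ⇒ `u ≤ ū` on `D̄`.
HONEST FRAMING: an abstract elliptic lemma filed as groundwork on the NEGATIVE side of a HYPOTHETICAL filament-type rotating-self-similar blow-up route (MODEL rung);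
24091/23611/23920 OPEN; nothing here bears on Navier–Stokes regularity, which is NOT proved.
-/

set_option linter.dupNamespace false

noncomputable section

namespace Summit.NavierStokesRegularity.NavierStokesRegularity.Theorems.DefectColumnGate

open scoped Topology InnerProductSpace Laplacian ContDiff
open Set Function Metric
open Literature.Analysis.FluidPDE

variable {E : Type} [NormedAddCommGroup E] [InnerProductSpace ℝ E] [FiniteDimensional ℝ E]

/-- **Ground-state transform identity.**  For `ψ, w ∈ C²(E; ℝ)`, any drift `b` and potential `c`, at every `x`:
`Δ(ψw) + D(ψw)[b] + c·ψw = ψ·(Δw + Dw[b]) + 2·Dw[∇ψ] + w·(Δψ + Dψ[b] + c·ψ)`. -/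
theorem laplacian_mul_drift_identity {ψ w : E → ℝ} (hψ : ContDiff ℝ 2 ψ) (hw : ContDiff ℝ 2 w) (b : E → E) (c : E → ℝ) (x : E) :
    (Δ (fun y => ψ y * w y)) x + fderiv ℝ (fun y => ψ y * w y) x (b x) + c x * (ψ x * w x)
      = ψ x * ((Δ w) x + fderiv ℝ w x (b x)) + 2 * fderiv ℝ w x (gradient ψ x)
        + w x * ((Δ ψ) x + fderiv ℝ ψ x (b x) + c x * ψ x) := by
  have hL : (Δ (fun y => ψ y * w y)) x = ψ x * (Δ w) x + 2 * fderiv ℝ w x (gradient ψ x) + (Δ ψ) x * w x := by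
    have h := laplacian_smul_field (E := E) (F' := ℝ) hψ hw x
    simpa only [smul_eq_mul] using h
  have hD : fderiv ℝ (fun y => ψ y * w y) x (b x) = ψ x * fderiv ℝ w x (b x) + w x * fderiv ℝ ψ x (b x) := by
    rw [fderiv_fun_mul (hψ.differentiable (by norm_num) x) (hw.differentiable (by norm_num) x)]
    simp only [FunLike.coe_add, Pi.add_apply, FunLike.coe_smul, Pi.smul_apply, smul_eq_mul]
  rw [hL, hD]
  ring

/-- **GENERALISED MINIMUM PRINCIPLE (Protter–Weinberger).**  Let `D ⊆ E` be bounded and open, `b : E → E` and `c : E → ℝ` bounded on `D`, and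
`L = Δ + b·∇ + c`.  Suppose `ψ ∈ C²(E)` is everywhere POSITIVE with `Lψ ≤ 0` on `D` (a positive supersolution / ground state).  Then every `h ∈ C²(E)` with `Lh ≤ 0` on
`D` and `h ≥ 0` on `∂D` satisfies `h ≥ 0` on `D̄` — whatever the sign of `c` and the size of `D`.  (Proof: `−h/ψ` is a subsolution of
`−Δ − (b + 2∇ψ/ψ)·∇ + (−Lψ/ψ)` with `−Lψ/ψ ≥ 0`; apply `PineauVicol2026.weak_maximum_principle`; `e` is any unit vector, used for its barrier.)
[cite: ProtterWeinberger1984, Ch. 2 §5 Theorem 10] -/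
theorem generalized_min_principle {D : Set E} (hD : IsOpen D) (hDb : Bornology.IsBounded D) {e : E} (he : ‖e‖ = 1)
    {ψ h : E → ℝ} (hψ : ContDiff ℝ 2 ψ) (hψpos : ∀ x, 0 < ψ x) (hh : ContDiff ℝ 2 h)
    {b : E → E} {c : E → ℝ} {B C : ℝ} (hb : ∀ x ∈ D, ‖b x‖ ≤ B) (hc : ∀ x ∈ D, |c x| ≤ C)
    (hψsup : ∀ x ∈ D, (Δ ψ) x + fderiv ℝ ψ x (b x) + c x * ψ x ≤ 0)
    (hhsup : ∀ x ∈ D, (Δ h) x + fderiv ℝ h x (b x) + c x * h x ≤ 0)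
    (hbdry : ∀ x ∈ frontier D, 0 ≤ h x) :
    ∀ x ∈ closure D, 0 ≤ h x := by
  -- empty domain: nothing to prove
  rcases D.eq_empty_or_nonempty with hDe | ⟨x₀, hx₀⟩
  · intro x hx; rw [hDe, closure_empty] at hx; exact absurd hx (notMem_empty x)
  have hB0 : 0 ≤ B := (norm_nonneg _).trans (hb x₀ hx₀)
  have hC0 : 0 ≤ C := (abs_nonneg _).trans (hc x₀ hx₀)
  -- the quotient `w = h/ψ`
  have hψne : ∀ y, ψ y ≠ 0 := fun y => (hψpos y).ne'
  set w : E → ℝ := fun y => h y / ψ y with hw_def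
  have hw : ContDiff ℝ 2 w := hh.div hψ hψne
  have hhw : h = fun y => ψ y * w y := by
    funext y; show h y = ψ y * (h y / ψ y); rw [mul_comm, div_mul_cancel₀ _ (hψne y)]
  -- continuity of the data built from `ψ`
  have hψc : Continuous ψ := hψ.continuous
  have hDψc : Continuous (fderiv ℝ ψ) := hψ.continuous_fderiv (by norm_num)
  have hgc : Continuous (gradient ψ) := by
    have : gradient ψ = fun y => (InnerProductSpace.toDual ℝ E).symm (fderiv ℝ ψ y) := rfl
    rw [this]; exact (InnerProductSpace.toDual ℝ E).symm.continuous.comp hDψc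
  have hΔψc : Continuous (Δ ψ) := continuous_laplacian hψ
  -- bounds on the compact closure
  have hK : IsCompact (closure D) := Metric.isCompact_of_isClosed_isBounded isClosed_closure hDb.closure
  obtain ⟨Ci, hCi⟩ := hK.exists_bound_of_continuousOn (f := fun y => (ψ y)⁻¹) (hψc.inv₀ hψne).continuousOn
  obtain ⟨G, hG⟩ := hK.exists_bound_of_continuousOn (f := gradient ψ) hgc.continuousOn
  obtain ⟨LΔ, hLΔ⟩ := hK.exists_bound_of_continuousOn (f := Δ ψ) hΔψc.continuousOn
  obtain ⟨Mψ, hMψ⟩ := hK.exists_bound_of_continuousOn (f := ψ) hψc.continuousOn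
  have hCi0 : 0 ≤ Ci := (norm_nonneg _).trans (hCi x₀ (subset_closure hx₀))
  have hG0 : 0 ≤ G := (norm_nonneg _).trans (hG x₀ (subset_closure hx₀))
  have hLΔ0 : 0 ≤ LΔ := (norm_nonneg _).trans (hLΔ x₀ (subset_closure hx₀))
  have hMψ0 : 0 ≤ Mψ := (norm_nonneg _).trans (hMψ x₀ (subset_closure hx₀))
  have hinv : ∀ y ∈ D, (ψ y)⁻¹ ≤ Ci := fun y hy => by
    have := hCi y (subset_closure hy); rw [Real.norm_eq_abs, abs_of_pos (inv_pos.mpr (hψpos y))] at this; exact this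
  -- the transformed drift and potential
  set bt : E → E := fun y => b y + (2 * (ψ y)⁻¹) • gradient ψ y with hbt
  set V : E → ℝ := fun y => -((Δ ψ) y + fderiv ℝ ψ y (b y) + c y * ψ y) * (ψ y)⁻¹ with hV
  have hbt_bd : ∀ y ∈ D, ‖bt y‖ ≤ B + 2 * Ci * G := by
    intro y hy
    have hψi : 0 < (ψ y)⁻¹ := inv_pos.mpr (hψpos y)
    have h1 : ‖(2 * (ψ y)⁻¹) • gradient ψ y‖ = 2 * (ψ y)⁻¹ * ‖gradient ψ y‖ := by
      rw [norm_smul, Real.norm_eq_abs, abs_of_pos (by positivity)]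
    have h2 : (ψ y)⁻¹ * ‖gradient ψ y‖ ≤ Ci * G := mul_le_mul (hinv y hy) (hG y (subset_closure hy)) (norm_nonneg _) hCi0
    calc ‖bt y‖ ≤ ‖b y‖ + ‖(2 * (ψ y)⁻¹) • gradient ψ y‖ := norm_add_le _ _
      _ ≤ B + 2 * Ci * G := by rw [h1]; linarith [hb y hy]
  have hV_nonneg : ∀ y ∈ D, 0 ≤ V y := fun y hy => by
    simp only [hV]
    exact mul_nonneg (neg_nonneg.mpr (hψsup y hy)) (inv_pos.mpr (hψpos y)).le
  have hV_bd : ∀ y ∈ D, V y ≤ (LΔ + G * B + C * Mψ) * Ci := by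
    intro y hy
    have h1 : |(Δ ψ) y| ≤ LΔ := by have := hLΔ y (subset_closure hy); rwa [Real.norm_eq_abs] at this
    have h2 : |fderiv ℝ ψ y (b y)| ≤ G * B := by
      rw [← InnerProductSpace.toDual_symm_apply, ← gradient]
      calc |⟪gradient ψ y, b y⟫_ℝ| ≤ ‖gradient ψ y‖ * ‖b y‖ := abs_real_inner_le_norm _ _
        _ ≤ G * B := mul_le_mul (hG y (subset_closure hy)) (hb y hy) (norm_nonneg _) hG0
    have h3 : |c y * ψ y| ≤ C * Mψ := by
      rw [abs_mul]
      have := hMψ y (subset_closure hy); rw [Real.norm_eq_abs] at this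
      exact mul_le_mul (hc y hy) this (abs_nonneg _) hC0
    have h4 : -((Δ ψ) y + fderiv ℝ ψ y (b y) + c y * ψ y) ≤ LΔ + G * B + C * Mψ := by
      have := abs_add_three ((Δ ψ) y) (fderiv ℝ ψ y (b y)) (c y * ψ y)
      linarith [neg_abs_le ((Δ ψ) y + fderiv ℝ ψ y (b y) + c y * ψ y)]
    have h5 : 0 ≤ LΔ + G * B + C * Mψ := by positivity
    simp only [hV]
    exact mul_le_mul h4 (hinv y hy) (inv_pos.mpr (hψpos y)).le h5
  -- `−w` is a subsolution of the transformed operator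
  have hφ : ContDiff ℝ 2 (-w) := hw.neg
  have hsub : ∀ y ∈ D, -(Δ (-w)) y - fderiv ℝ (-w) y (bt y) + V y * (-w) y ≤ 0 := by
    intro y hy
    have hid := laplacian_mul_drift_identity hψ hw b c y
    have hLh : (Δ (fun z => ψ z * w z)) y + fderiv ℝ (fun z => ψ z * w z) y (b y) + c y * (ψ y * w y) ≤ 0 := by
      have := hhsup y hy
      rw [hhw] at this
      exact this
    rw [hid] at hLh
    -- `Δ(-w) = -Δw`, `D(-w) = -Dw`, and the transformed drift
    have hΔ : (Δ (-w)) y = -(Δ w) y := by rw [InnerProductSpace.laplacian_neg]; rfl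
    have hDn : fderiv ℝ (-w) y (bt y) = -(fderiv ℝ w y (bt y)) := by rw [fderiv_neg]; rfl
    have hDbt : fderiv ℝ w y (bt y) = fderiv ℝ w y (b y) + 2 * (ψ y)⁻¹ * fderiv ℝ w y (gradient ψ y) := by
      simp only [hbt, map_add, map_smul, smul_eq_mul]
    rw [hΔ, hDn, hDbt, Pi.neg_apply]
    -- multiply the target by `ψ y > 0`: it becomes `hLh`
    have hψy := hψpos y
    have key : ψ y * (-(-(Δ w) y) - -(fderiv ℝ w y (b y) + 2 * (ψ y)⁻¹ * fderiv ℝ w y (gradient ψ y)) + V y * -w y)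
        = ψ y * ((Δ w) y + fderiv ℝ w y (b y)) + 2 * fderiv ℝ w y (gradient ψ y)
          + w y * ((Δ ψ) y + fderiv ℝ ψ y (b y) + c y * ψ y) := by
      simp only [hV]
      field_simp
      ring
    by_contra hcon
    push Not at hcon
    have := mul_pos hψy hcon
    rw [key] at this
    linarith
  have hbdry' : ∀ y ∈ frontier D, (-w) y ≤ 0 := fun y hy => by
    simp only [Pi.neg_apply, hw_def, neg_nonpos]
    exact div_nonneg (hbdry y hy) (hψpos y).le
  have hmax := PineauVicol2026.weak_maximum_principle hD hDb he hφ (B := B + 2 * Ci * G) (V₀ := (LΔ + G * B + C * Mψ) * Ci)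
    (by positivity) (by positivity) hbt_bd hV_nonneg hV_bd hsub le_rfl hbdry'
  intro x hx
  have h1 : 0 ≤ w x := by have := hmax x hx; simp only [Pi.neg_apply] at this; linarith
  rw [hhw]
  exact mul_nonneg (hψpos x).le h1

/-- **Generalised comparison principle.**  Under the same structure (bounded open `D`, bounded `b`, `c`, a positive `C²` supersolution `ψ` of `L = Δ + b·∇ + c` on `D`):
if `u, ū ∈ C²(E)` satisfy `L ū ≤ L u` on `D` (e.g. `L ū ≤ f ≤ L u`) and `u ≤ ū` on `∂D`, then `u ≤ ū` on `D̄`. -/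
theorem generalized_comparison {D : Set E} (hD : IsOpen D) (hDb : Bornology.IsBounded D) {e : E} (he : ‖e‖ = 1)
    {ψ u ub : E → ℝ} (hψ : ContDiff ℝ 2 ψ) (hψpos : ∀ x, 0 < ψ x) (hu : ContDiff ℝ 2 u) (hub : ContDiff ℝ 2 ub)
    {b : E → E} {c : E → ℝ} {B C : ℝ} (hb : ∀ x ∈ D, ‖b x‖ ≤ B) (hc : ∀ x ∈ D, |c x| ≤ C)
    (hψsup : ∀ x ∈ D, (Δ ψ) x + fderiv ℝ ψ x (b x) + c x * ψ x ≤ 0)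
    (hL : ∀ x ∈ D, (Δ ub) x + fderiv ℝ ub x (b x) + c x * ub x ≤ (Δ u) x + fderiv ℝ u x (b x) + c x * u x)
    (hbdry : ∀ x ∈ frontier D, u x ≤ ub x) :
    ∀ x ∈ closure D, u x ≤ ub x := by
  have hh : ContDiff ℝ 2 (fun y => ub y - u y) := hub.sub hu
  have hhsup : ∀ x ∈ D, (Δ (fun y => ub y - u y)) x + fderiv ℝ (fun y => ub y - u y) x (b x) + c x * (ub x - u x) ≤ 0 := by
    intro x hx
    have h1 : (Δ (fun y => ub y - u y)) x = (Δ ub) x - (Δ u) x :=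
      (hub.contDiffAt (x := x)).laplacian_sub (hu.contDiffAt (x := x))
    rw [h1, fderiv_fun_sub (hub.differentiable (by norm_num) x) (hu.differentiable (by norm_num) x)]
    simp only [FunLike.coe_sub, Pi.sub_apply]
    linarith [hL x hx]
  intro x hx
  have := generalized_min_principle hD hDb he hψ hψpos hh hb hc hψsup hhsup (fun y hy => sub_nonneg.mpr (hbdry y hy)) x hx
  linarith

end Summit.NavierStokesRegularity.NavierStokesRegularity.Theorems.DefectColumnGate

end
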